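import Mathlib

/-!
# `t`-polynomial solutions of the 1+1 wave equation `ψ_tt − ψ_xx + V(x)ψ = 0` from a coefficient chain

Analysis/PDE support file (everything proved, no definitions). If `C_0, …, C_H` (`H = ⌊N/2⌋`) are `C²`
functions on an open set `S ⊆ ℝ` with

  `C_0'' = V C_0`,   `C_m'' = V C_m + (N−2m+2)(N−2m+1) C_{m−1}`   (`1 ≤ m ≤ H`),

then `p(t,x) = Σ_{m ≤ H} C_m(x) t^{N−2m}` is a `C²` function on `ℝ × S` solving
`p_tt − p_xx + V p = 0` there (`iteratedDeriv` form of the route items), it is a polynomial in `t`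
with `x`-dependent coefficients, and its Cauchy data at `t = 0` are `(C_H, 0)` for even `N` and
`(0, C_H)` for odd `N` (`exists_tPolynomial_waveSolution`). Elementary; used for the far-side
`t`-polynomial kernel of the Regge–Wheeler channel estimate (route PhotonSphereChannels,
`FixedModeChannels`, stmt-FinalStateConjecture-10048).
-/

noncomputable section

namespace Literature.Analysis.PDE

open Set Filter Topology Finset

/-! ### Second derivatives of finite combinations -/

/-- `x`-derivatives: for `F m` of class `C²` on an open `S` and constants `a m`,
`iteratedDeriv 2 (Σ_m F m · a m) x = Σ_m (iteratedDeriv 2 (F m) x) a m` at `x ∈ S`. [folklore] -/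
theorem iteratedDeriv_two_sum_mul_const {S : Set ℝ} (hS : IsOpen S) {ι : Type*} (s : Finset ι)
    {F : ι → ℝ → ℝ} (hF : ∀ m ∈ s, ContDiffOn ℝ 2 (F m) S) (a : ι → ℝ) {x : ℝ} (hx : x ∈ S) :
    iteratedDeriv 2 (fun y => ∑ m ∈ s, F m y * a m) x = ∑ m ∈ s, iteratedDeriv 2 (F m) x * a m := by
  have hdiff : ∀ m ∈ s, DifferentiableOn ℝ (F m) S := fun m hm =>
    (hF m hm).differentiableOn (by decide)
  have hdiff' : ∀ m ∈ s, DifferentiableOn ℝ (deriv (F m)) S := fun m hm =>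
    (((contDiffOn_succ_iff_deriv_of_isOpen (n := 1) hS).1 (hF m hm)).2.2).differentiableOn
      (by decide)
  -- first derivative on `S`
  have h1 : ∀ y ∈ S, HasDerivAt (fun y => ∑ m ∈ s, F m y * a m) (∑ m ∈ s, deriv (F m) y * a m) y := by
    intro y hy
    refine HasDerivAt.fun_sum fun m hm => ?_
    exact ((hdiff m hm y hy).differentiableAt (hS.mem_nhds hy)).hasDerivAt.mul_const _
  have hd1 : deriv (fun y => ∑ m ∈ s, F m y * a m) =ᶠ[𝓝 x] fun y => ∑ m ∈ s, deriv (F m) y * a m :=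
    Filter.eventuallyEq_of_mem (hS.mem_nhds hx) fun y hy => (h1 y hy).deriv
  -- second derivative at `x`
  have h2 : HasDerivAt (fun y => ∑ m ∈ s, deriv (F m) y * a m)
      (∑ m ∈ s, deriv (deriv (F m)) x * a m) x := by
    refine HasDerivAt.fun_sum fun m hm => ?_
    exact ((hdiff' m hm x hx).differentiableAt (hS.mem_nhds hx)).hasDerivAt.mul_const _
  rw [iteratedDeriv_succ, iteratedDeriv_one, hd1.deriv_eq, h2.deriv]
  refine Finset.sum_congr rfl fun m _ => ?_
  rw [iteratedDeriv_succ, iteratedDeriv_one]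

/-- `t`-derivatives of a polynomial with exponents `k m`:
`iteratedDeriv 2 (Σ_m b m τ^{k m}) t = Σ_m b m · k m (k m − 1) t^{k m − 2}`. [folklore] -/
theorem iteratedDeriv_two_sum_pow {ι : Type*} (s : Finset ι) (b : ι → ℝ) (k : ι → ℕ) (t : ℝ) :
    iteratedDeriv 2 (fun τ => ∑ m ∈ s, b m * τ ^ k m) t
      = ∑ m ∈ s, b m * (((k m : ℕ) : ℝ) * (((k m - 1 : ℕ) : ℝ) * t ^ (k m - 1 - 1))) := by
  have h1 : ∀ τ : ℝ, HasDerivAt (fun τ => ∑ m ∈ s, b m * τ ^ k m)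
      (∑ m ∈ s, b m * (((k m : ℕ) : ℝ) * τ ^ (k m - 1))) τ := fun τ =>
    HasDerivAt.fun_sum fun m _ => (hasDerivAt_pow (k m) τ).const_mul _
  have hd1 : deriv (fun τ => ∑ m ∈ s, b m * τ ^ k m)
      = fun τ => ∑ m ∈ s, b m * (((k m : ℕ) : ℝ) * τ ^ (k m - 1)) := funext fun τ => (h1 τ).deriv
  have h2 : HasDerivAt (fun τ => ∑ m ∈ s, b m * (((k m : ℕ) : ℝ) * τ ^ (k m - 1)))
      (∑ m ∈ s, b m * (((k m : ℕ) : ℝ) * (((k m - 1 : ℕ) : ℝ) * t ^ (k m - 1 - 1)))) t :=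
    HasDerivAt.fun_sum fun m _ => ((hasDerivAt_pow (k m - 1) t).const_mul _).const_mul _
  rw [iteratedDeriv_succ, iteratedDeriv_one, hd1, h2.deriv]

/-! ### The `t`-polynomial solution -/

/-- **`t`-polynomial solutions from a coefficient chain.** See the module docstring. [folklore] -/
theorem exists_tPolynomial_waveSolution {V : ℝ → ℝ} {S : Set ℝ} (hS : IsOpen S) (N : ℕ) {C : ℕ → ℝ → ℝ} (hC : ∀ m, 2 * m ≤ N → ContDiffOn ℝ 2 (C m) S)
    (h0 : ∀ x ∈ S, iteratedDeriv 2 (C 0) x = V x * C 0 x)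
    (hrec : ∀ m, 1 ≤ m → 2 * m ≤ N → ∀ x ∈ S, iteratedDeriv 2 (C m) x
      = V x * C m x + ((N : ℝ) - 2 * m + 2) * ((N : ℝ) - 2 * m + 1) * C (m - 1) x) :
    ∃ p : ℝ → ℝ → ℝ, (∀ t x, p t x = ∑ m ∈ Finset.range (N / 2 + 1), C m x * t ^ (N - 2 * m))
      ∧ ContDiffOn ℝ 2 (Function.uncurry p) (Set.univ ×ˢ S)
      ∧ (∀ t, ∀ x ∈ S,
          iteratedDeriv 2 (fun τ => p τ x) t - iteratedDeriv 2 (p t) x + V x * p t x = 0)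
      ∧ (∃ (Np : ℕ) (a : ℕ → ℝ → ℝ), ∀ t x, p t x = ∑ i ∈ Finset.range Np, a i x * t ^ i)
      ∧ (Even N → ∀ x, p 0 x = C (N / 2) x ∧ deriv (fun τ => p τ x) 0 = 0)
      ∧ (¬ Even N → ∀ x, p 0 x = 0 ∧ deriv (fun τ => p τ x) 0 = C (N / 2) x) := by
  set H : ℕ := N / 2 with hH
  have hHN : 2 * H ≤ N := Nat.mul_div_le N 2
  set p : ℝ → ℝ → ℝ := fun t x => ∑ m ∈ Finset.range (H + 1), C m x * t ^ (N - 2 * m) with hp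
  have hp_apply : ∀ t x, p t x = ∑ m ∈ Finset.range (H + 1), C m x * t ^ (N - 2 * m) := fun t x => rfl
  have hmem : ∀ {m}, m ∈ Finset.range (H + 1) → 2 * m ≤ N := fun {m} hm => by
    have := Finset.mem_range.1 hm; omega
  refine ⟨p, hp_apply, ?_, fun t x hx => ?_, ?_, fun hev x => ?_, fun hodd x => ?_⟩
  · -- joint `C²`
    have : Function.uncurry p = fun z : ℝ × ℝ => ∑ m ∈ Finset.range (H + 1), C m z.2 * z.1 ^ (N - 2 * m) := by
      funext z; rfl
    rw [this]
    refine ContDiffOn.sum fun m hm => ContDiffOn.mul ?_ (contDiffOn_fst.pow _)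
    exact (hC m (hmem hm)).comp contDiffOn_snd fun z hz => (Set.mem_prod.1 hz).2
  · -- the equation
    have hT : iteratedDeriv 2 (fun τ => p τ x) t = ∑ m ∈ Finset.range (H + 1),
        C m x * ((((N - 2 * m : ℕ) : ℕ) : ℝ) * ((((N - 2 * m) - 1 : ℕ) : ℝ) * t ^ (N - 2 * m - 1 - 1))) :=
      iteratedDeriv_two_sum_pow _ (fun m => C m x) (fun m => N - 2 * m) t
    have hXd : iteratedDeriv 2 (p t) x
        = ∑ m ∈ Finset.range (H + 1), iteratedDeriv 2 (C m) x * t ^ (N - 2 * m) :=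
      iteratedDeriv_two_sum_mul_const hS _ (fun m hm => hC m (hmem hm)) _ hx
    -- rewrite the second `x`-derivatives with the chain relations: split off `m = 0` and shift
    have hXd' : iteratedDeriv 2 (p t) x = V x * p t x
        + ∑ m ∈ Finset.range H, ((N : ℝ) - 2 * (m + 1 : ℕ) + 2) * ((N : ℝ) - 2 * (m + 1 : ℕ) + 1)
            * C m x * t ^ (N - 2 * (m + 1)) := by
      rw [hXd, hp_apply, Finset.mul_sum, Finset.sum_range_succ' (fun m => iteratedDeriv 2 (C m) x * _),
        Finset.sum_range_succ' (fun m => V x * (C m x * t ^ (N - 2 * m)))]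
      rw [h0 x hx]
      have hsum : ∑ m ∈ Finset.range H, iteratedDeriv 2 (C (m + 1)) x * t ^ (N - 2 * (m + 1))
          = ∑ m ∈ Finset.range H, V x * (C (m + 1) x * t ^ (N - 2 * (m + 1)))
            + ∑ m ∈ Finset.range H, ((N : ℝ) - 2 * (m + 1 : ℕ) + 2) * ((N : ℝ) - 2 * (m + 1 : ℕ) + 1)
              * C m x * t ^ (N - 2 * (m + 1)) := by
        rw [← Finset.sum_add_distrib]
        refine Finset.sum_congr rfl fun m hm => ?_
        have hm' : 2 * (m + 1) ≤ N := by have := Finset.mem_range.1 hm; omega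
        rw [hrec (m + 1) (by omega) hm' x hx, Nat.add_sub_cancel]
        ring
      rw [hsum]
      ring
    -- the second `t`-derivatives: split off the last index `m = H` (vanishing factor) and compare
    have hT' : iteratedDeriv 2 (fun τ => p τ x) t
        = ∑ m ∈ Finset.range H, ((N : ℝ) - 2 * (m + 1 : ℕ) + 2) * ((N : ℝ) - 2 * (m + 1 : ℕ) + 1)
            * C m x * t ^ (N - 2 * (m + 1)) := by
      rw [hT, Finset.sum_range_succ]
      have hlast : C H x * ((((N - 2 * H : ℕ) : ℕ) : ℝ) * ((((N - 2 * H) - 1 : ℕ) : ℝ)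
          * t ^ (N - 2 * H - 1 - 1))) = 0 := by
        have : N - 2 * H = 0 ∨ N - 2 * H = 1 := by omega
        rcases this with h | h <;> simp [h]
      rw [hlast, add_zero]
      refine Finset.sum_congr rfl fun m hm => ?_
      have hm' : 2 * (m + 1) ≤ N := by have := Finset.mem_range.1 hm; omega
      obtain ⟨j, hj⟩ : ∃ j, N - 2 * m = j + 2 := ⟨N - 2 * (m + 1), by omega⟩
      have hj' : N - 2 * (m + 1) = j := by omega
      have hjr : ((N : ℝ) - 2 * (m + 1 : ℕ)) = j := by
        have : ((N - 2 * (m + 1) : ℕ) : ℝ) = (j : ℝ) := by rw [hj']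
        rw [← this, Nat.cast_sub hm']
        push_cast; ring
      rw [hj, hj', show j + 2 - 1 = j + 1 by omega, show j + 1 - 1 = j by omega]
      have e1 : ((N : ℝ) - 2 * (m + 1 : ℕ) + 2) = ((j + 2 : ℕ) : ℝ) := by rw [hjr]; push_cast; ring
      have e2 : ((N : ℝ) - 2 * (m + 1 : ℕ) + 1) = ((j + 1 : ℕ) : ℝ) := by rw [hjr]; push_cast; ring
      rw [e1, e2]
      ring
    rw [hT', hXd']
    ring
  · -- polynomial in `t` with `x`-dependent coefficients
    refine ⟨N + 1, fun i x => ∑ m ∈ Finset.range (H + 1), if N - 2 * m = i then C m x else 0, ?_⟩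
    intro t x
    rw [hp_apply]
    simp_rw [Finset.sum_mul, ite_mul, zero_mul]
    rw [Finset.sum_comm]
    refine Finset.sum_congr rfl fun m hm => ?_
    rw [Finset.sum_ite_eq]
    rw [if_pos (Finset.mem_range.2 (by omega))]
  · -- data, even `N`: `2H = N`
    have hH2 : N - 2 * H = 0 := by obtain ⟨k, hk⟩ := hev; omega
    constructor
    · rw [hp_apply, Finset.sum_eq_single_of_mem H (Finset.mem_range.2 (by omega))]
      · rw [hH2, pow_zero, mul_one]
      · intro m hm hmH
        have : N - 2 * m ≠ 0 := by have := Finset.mem_range.1 hm; omega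
        rw [zero_pow this, mul_zero]
    · have h1 : HasDerivAt (fun τ => p τ x)
          (∑ m ∈ Finset.range (H + 1), C m x * ((((N - 2 * m : ℕ) : ℕ) : ℝ) * (0 : ℝ) ^ (N - 2 * m - 1))) 0 :=
        HasDerivAt.fun_sum fun m _ => (hasDerivAt_pow (N - 2 * m) (0 : ℝ)).const_mul _
      rw [h1.deriv]
      refine Finset.sum_eq_zero fun m hm => ?_
      rcases Nat.eq_or_lt_of_le (show m ≤ H from Nat.lt_succ_iff.1 (Finset.mem_range.1 hm)) with h | h
      · subst h; rw [hH2]; simp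
      · have : N - 2 * m - 1 ≠ 0 := by omega
        rw [zero_pow this]; simp
  · -- data, odd `N`: `2H + 1 = N`
    have hH2 : N - 2 * H = 1 := by
      rcases Nat.even_or_odd N with h | ⟨k, hk⟩
      · exact absurd h hodd
      · omega
    constructor
    · rw [hp_apply]
      refine Finset.sum_eq_zero fun m hm => ?_
      have : N - 2 * m ≠ 0 := by have := Finset.mem_range.1 hm; omega
      rw [zero_pow this, mul_zero]
    · have h1 : HasDerivAt (fun τ => p τ x)
          (∑ m ∈ Finset.range (H + 1), C m x * ((((N - 2 * m : ℕ) : ℕ) : ℝ) * (0 : ℝ) ^ (N - 2 * m - 1))) 0 :=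
        HasDerivAt.fun_sum fun m _ => (hasDerivAt_pow (N - 2 * m) (0 : ℝ)).const_mul _
      rw [h1.deriv, Finset.sum_eq_single_of_mem H (Finset.mem_range.2 (by omega))]
      · rw [hH2]; simp
      · intro m hm hmH
        have : N - 2 * m - 1 ≠ 0 := by have := Finset.mem_range.1 hm; omega
        rw [zero_pow this]; simp

end Literature.Analysis.PDE
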